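import Mathlib

/-!
# The unit ball `𝔹² ⊂ ℂ²` as a homogeneous space of `U(2,1)`: the form, the group, the action, the Jacobian, the wedge

Part of the self-contained statement set `Summits/Ventures/HodgeRepro/Statements.lean` (statement (c), the Hecke-translate
wedge).  Nothing is proved or asserted in this file; nothing here says anything about the status of the Hodge conjecture for CM abelian varieties, which is NOT proved.

## C.  The Hecke-translate wedge on the complex `2`-ball

The BALL MODEL of the complex hyperbolic plane: `U(2,1) = {g ∈ GL₃(ℂ) : gᴴ J g = J}`, `J = diag(1, 1, -1)`, acts on the unit ball
`𝔹² = {z ∈ ℂ² : |z₀|² + |z₁|² < 1}` by the fractional-linear maps `g • z = ((g(z,1))₀, (g(z,1))₁) / (g(z,1))₂` (Jacobowitz, *An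
Introduction to CR Structures*, AMS 1990, Ch. 2 §1; Rudin, *Function Theory in the Unit Ball of ℂⁿ*, Thm. 2.2.3), with
Jacobian `J_g(z) = ((g_{ij} w₂ − w_i g_{2j}) / w₂²)_{i,j<2}`, `w = g(z,1)`.  A cotangent field is `F : 𝔹² → ℂ²` (the `(1,0)`-form
`F₀ dz₀ + F₁ dz₁`); its pull-back (translate) by `γ` is `γ^*F = z ↦ J_γ(z)ᵀ F(γ z)`; the wedge of two covectors is
`u ∧ v = u₀ v₁ − u₁ v₀`.  The statement: for a DENSE subgroup `Δ ≤ U(2,1)` and two continuous, not identically zero fields `F, G`,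
some single translate `γ^*F`, `γ ∈ Δ`, has a non-zero wedge with `G` at some point.  On a compact ball quotient (a Picard modular
surface) with `Δ` the image of the rational points of the unitary group (dense by real approximation) and `F, G` the lifts of two
non-zero holomorphic one-forms, this is the pointwise core of the non-vanishing of `T_γ^* a ∧ a′` for a Hecke correspondence `T_γ`
— the holomorphic case of Clozel, J. reine angew. Math. 444 (1993) and Venkataramana, Compositio Math. 125 (2001), Thm. 8.
-/

set_option autoImplicit false

noncomputable section

namespace Summit.Ventures.HodgeRepro

namespace BallModel

open Matrix Complex ComplexConjugate

/-- `J = diag(1, 1, -1)` on `ℂ³`. -/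
def J : Matrix (Fin 3) (Fin 3) ℂ := Matrix.diagonal ![1, 1, -1]

/-- `det J = -1`. -/
theorem det_J : J.det = -1 := by simp [J, Matrix.det_diagonal, Fin.prod_univ_three]

/-- `GL₃(ℂ)`. -/
abbrev GL3 : Type := GL (Fin 3) ℂ

/-- `U(2,1) = {g ∈ GL₃(ℂ) : gᴴ J g = J}` as a subgroup of `GL₃(ℂ)`. -/
def U21 : Subgroup GL3 where
  carrier := {g | (g : Matrix (Fin 3) (Fin 3) ℂ)ᴴ * J * (g : Matrix (Fin 3) (Fin 3) ℂ) = J}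
  mul_mem' := by
    intro g h hg hh
    simp only [Set.mem_setOf_eq, Units.val_mul, conjTranspose_mul] at hg hh ⊢
    calc (h : Matrix (Fin 3) (Fin 3) ℂ)ᴴ * (g : Matrix (Fin 3) (Fin 3) ℂ)ᴴ * J *
          ((g : Matrix (Fin 3) (Fin 3) ℂ) * (h : Matrix (Fin 3) (Fin 3) ℂ))
        = (h : Matrix (Fin 3) (Fin 3) ℂ)ᴴ * ((g : Matrix (Fin 3) (Fin 3) ℂ)ᴴ * J *
          (g : Matrix (Fin 3) (Fin 3) ℂ)) * (h : Matrix (Fin 3) (Fin 3) ℂ) := by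
          simp only [Matrix.mul_assoc]
      _ = J := by rw [hg, hh]
  one_mem' := by simp
  inv_mem' := by
    intro g hg
    simp only [Set.mem_setOf_eq] at hg ⊢
    set gi : Matrix (Fin 3) (Fin 3) ℂ := ((g⁻¹ : GL3) : Matrix (Fin 3) (Fin 3) ℂ) with hgi
    have hmul : (g : Matrix (Fin 3) (Fin 3) ℂ) * gi = 1 := by
      rw [hgi, ← Units.val_mul, mul_inv_cancel, Units.val_one]
    calc giᴴ * J * gi = giᴴ * ((g : Matrix (Fin 3) (Fin 3) ℂ)ᴴ * J * (g : Matrix (Fin 3) (Fin 3) ℂ)) * gi := by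
          rw [hg]
      _ = ((g : Matrix (Fin 3) (Fin 3) ℂ) * gi)ᴴ * J * ((g : Matrix (Fin 3) (Fin 3) ℂ) * gi) := by
          simp only [conjTranspose_mul, Matrix.mul_assoc]
      _ = J := by rw [hmul]; simp

/-- The matrix of an element of `U(2,1)`. -/
abbrev mat (g : U21) : Matrix (Fin 3) (Fin 3) ℂ := ((g : GL3) : Matrix (Fin 3) (Fin 3) ℂ)

/-- The defining relation `gᴴ J g = J`. -/
theorem mat_mem (g : U21) : (mat g)ᴴ * J * mat g = J := g.2

/-- The real quadratic form `Q(v) = |v₀|² + |v₁|² - |v₂|²` of `J`. -/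
def Q (v : Fin 3 → ℂ) : ℝ := ‖v 0‖ ^ 2 + ‖v 1‖ ^ 2 - ‖v 2‖ ^ 2

/-- `v̄ᵀ J v = Q(v)`. -/
theorem form_eq_Q (v : Fin 3 → ℂ) : star v ⬝ᵥ (J *ᵥ v) = ((Q v : ℝ) : ℂ) := by
  have h0 := Complex.conj_mul' (v 0)
  have h1 := Complex.conj_mul' (v 1)
  have h2 := Complex.conj_mul' (v 2)
  simp only [J, mulVec_diagonal, dotProduct, Fin.sum_univ_three, Pi.star_apply, Complex.star_def, Q,
    Matrix.cons_val_zero, Matrix.cons_val_one, Matrix.cons_val]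
  push_cast
  linear_combination h0 + h1 - h2

/-- A matrix preserving `J` preserves the sesquilinear form `v̄ᵀ J v`. -/
theorem form_invariant {g : Matrix (Fin 3) (Fin 3) ℂ} (h : gᴴ * J * g = J) (v : Fin 3 → ℂ) :
    star (g *ᵥ v) ⬝ᵥ (J *ᵥ (g *ᵥ v)) = star v ⬝ᵥ (J *ᵥ v) := by
  rw [Matrix.star_mulVec, Matrix.mulVec_mulVec, Matrix.dotProduct_mulVec, Matrix.vecMul_vecMul,
    ← Matrix.mul_assoc, h, ← Matrix.dotProduct_mulVec]

/-- `Q(g v) = Q(v)` for `g` preserving `J`. -/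
theorem Q_mulVec {g : Matrix (Fin 3) (Fin 3) ℂ} (h : gᴴ * J * g = J) (v : Fin 3 → ℂ) : Q (g *ᵥ v) = Q v := by
  have := form_invariant h v
  rw [form_eq_Q, form_eq_Q] at this
  exact_mod_cast this

/-- `|z₀|² + |z₁|²`. -/
def nsq (z : Fin 2 → ℂ) : ℝ := ‖z 0‖ ^ 2 + ‖z 1‖ ^ 2

/-- The complex `2`-ball `𝔹² = {z ∈ ℂ² : |z₀|² + |z₁|² < 1}` (a type). -/
def Ball : Type := {z : Fin 2 → ℂ // nsq z < 1}

/-- The subspace topology of `𝔹² ⊂ ℂ²`. -/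
instance : TopologicalSpace Ball := instTopologicalSpaceSubtype

/-- The lift `z ↦ (z₀, z₁, 1) ∈ ℂ³` of a point of the ball (homogeneous coordinates with `w₂ = 1`). -/
def lift (z : Ball) : Fin 3 → ℂ := ![z.1 0, z.1 1, 1]

/-- The lift of a point of the ball is `J`-negative. -/
theorem Q_lift (z : Ball) : Q (lift z) < 0 := by
  have := z.2
  simp only [Q, lift, nsq, Matrix.cons_val_zero, Matrix.cons_val_one, Matrix.cons_val, norm_one, one_pow] at this ⊢
  linarith

/-- For a `J`-negative vector the last coordinate does not vanish. -/
theorem ne_zero_of_Q_neg {w : Fin 3 → ℂ} (hw : Q w < 0) : w 2 ≠ 0 := by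
  intro h; simp only [Q, h, norm_zero] at hw; nlinarith [sq_nonneg ‖w 0‖, sq_nonneg ‖w 1‖]

/-- Projection of a `J`-negative vector to the ball: `w ↦ (w₀/w₂, w₁/w₂)`. -/
noncomputable def proj (w : Fin 3 → ℂ) (hw : Q w < 0) : Ball :=
  ⟨![w 0 / w 2, w 1 / w 2], by
    have h2 := ne_zero_of_Q_neg hw
    have hpos : 0 < ‖w 2‖ ^ 2 := by positivity
    simp only [nsq, Matrix.cons_val_zero, Matrix.cons_val_one, norm_div, div_pow]
    rw [← add_div, div_lt_one hpos]
    simp only [Q] at hw; linarith⟩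

/-- The image `g · (z, 1)` of the lift. -/
noncomputable def W3 (g : U21) (z : Ball) : Fin 3 → ℂ := mat g *ᵥ lift z

/-- `g · (z, 1)` is `J`-negative. -/
theorem Q_W3 (g : U21) (z : Ball) : Q (W3 g z) < 0 := by
  unfold W3; rw [Q_mulVec (mat_mem g)]; exact Q_lift z

/-- The denominator `(g · (z,1))₂` of the action never vanishes on the ball. -/
theorem W3_2_ne_zero (g : U21) (z : Ball) : W3 g z 2 ≠ 0 := ne_zero_of_Q_neg (Q_W3 g z)

/-- The action `act g z := proj (g · lift z)`, i.e. the fractional-linear map `z ↦ ((g(z,1))₀, (g(z,1))₁) / (g(z,1))₂`. -/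
noncomputable def act (g : U21) (z : Ball) : Ball := proj (W3 g z) (Q_W3 g z)

/-- Jacobian matrix of `z ↦ act g z` at `z` in the coordinates `z₀, z₁`: with `w = g·(z,1)`,
`∂(w_i/w₂)/∂z_j = (g_{ij} w₂ - w_i g_{2j}) / w₂²`. -/
noncomputable def Jac (g : U21) (z : Ball) : Matrix (Fin 2) (Fin 2) ℂ :=
  Matrix.of fun i j => (mat g (Fin.castSucc i) (Fin.castSucc j) * W3 g z 2 -
    W3 g z (Fin.castSucc i) * mat g 2 (Fin.castSucc j)) / W3 g z 2 ^ 2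

/-- `a ∧ b = a₀ b₁ - a₁ b₀`. -/
def wedge (a b : Fin 2 → ℂ) : ℂ := a 0 * b 1 - a 1 * b 0

end BallModel

end Summit.Ventures.HodgeRepro

end
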